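import Literature.Probability.Percolation.Percolation
import HarnessLib

/-!
# Reduction of arbitrary edge weights to weight `1/2`: series–parallel gadgets (the graph)

Topic `Literature/Probability/Percolation`. Kozma–Nitzan, *A reduction of the `θ(p_c) = 0`
problem to a conjectured inequality*, arXiv:2401.12397, §5.6 item (1) ("possible and impossible
generalisations"): a statement about connection probabilities on finite graphs with ARBITRARY
edge probabilities reduces to the same statement for the uniform probability `1/2` on simple
graphs, because an edge of probability `p` may be replaced by a two-terminal series–parallel
network of probability-`1/2` edges whose reliability approximates `p` (Moore–Shannon), and such a
replacement does not change the connection probabilities among the original vertices.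

This file is the COMBINATORIAL half of that reduction (no measure theory): the gadget graph and
the exact correspondence of connections. The probabilistic half (the law of the contracted
configuration is an inhomogeneous product Bernoulli measure with the gadget reliabilities as
weights) is `SeriesParallelReductionLaw.lean`.

## The gadget (namespace `HalfGadget`)

Fix a vertex type `V`, a bound `M` on multiplicities, a length parameter `ℓ` and multiplicities
`m : Sym2 V → ℕ`. The gadget graph `HalfGadget.graph M ℓ m` lives on
`HalfGadget.Vertex V M ℓ = V ⊕ (Sym2 V × Fin M × Fin (ℓ + 1))`: for every NON-DIAGONAL pair `e`
and every `j < min (m e) M` (`HalfGadget.Active m e j`) it contains a path of `ℓ + 2` edges from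
`Sum.inl (src e)` through the fresh internal vertices `Sum.inr (e, j, 0), …, Sum.inr (e, j, ℓ)` to
`Sum.inl (tgt e)`, where `s(src e, tgt e) = e` is a chosen orientation (`Quot.out`); there are no
other edges (in particular no edges between original vertices, so the graph is simple whatever
the multiplicities). Positions on a path are `HalfGadget.pos e j : Fin (ℓ + 3) → Vertex`, its
edges `HalfGadget.edge e j : Fin (ℓ + 2) → Sym2 Vertex`.

The CONTRACTION `HalfGadget.contract m ω ⊆ Sym2 V` of a bond configuration `ω` of the gadget
graph declares the pair `e` open iff some active path over `e` is entirely open in `ω`.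

## Main statement

`HalfGadget.contract_mem_openConn_iff`: for `ω ⊆ E(graph)`, `contract m ω ∈ {u ↔ v}` iff
`ω ∈ {inl u ↔ inl v}` — connections among original vertices are read off exactly from the
contracted configuration. (`⇐`: an open path over `e` joins its endpoints. `⇒`: label every
internal vertex of a not-entirely-open path by the endpoint on its side of a closed edge of that
path; every open edge then joins two vertices with equal labels or, on an entirely open path,
labels adjacent in the contraction.)

Design notes. The orientation `src`/`tgt` is an arbitrary choice (`Quot.out`); nothing depends
on it. Diagonal pairs `s(v, v)` get no gadget and are never in the contraction (they are
irrelevant to `openGraph = SimpleGraph.fromEdgeSet`). Inactive indices `j ≥ m e` leave isolated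
internal vertices, which is harmless. Mathlib anchors: `SimpleGraph.fromRel`, `Sym2`,
`SimpleGraph.Reachable`, `Fin.induction`; tree anchors: `openGraph`, `openConn`.

## References
* G. Kozma, S. Nitzan, arXiv:2401.12397 (2024), §5.6 (1). [KozmaNitzan2024]
* E. F. Moore, C. E. Shannon, *Reliable circuits using less reliable relays*, J. Franklin Inst.
  262 (1956) (two-terminal reliability of series–parallel networks). [MooreShannon1956]
* G. Grimmett, *Percolation*, 2nd ed. (1999), §1.3 (bond percolation on a graph). [Grimmett1999]
-/

namespace Literature.Probability.Percolation

namespace HalfGadget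

variable {V : Type*} {M ℓ : ℕ}

/-- The vertex type of the gadget graph: original vertices `Sum.inl v` and internal vertices
`Sum.inr (e, j, k)`, the `k`-th internal vertex (`k ≤ ℓ`) of the `j`-th path (`j < M`) over the
pair `e`. [cite: KozmaNitzan2024, §5.6 (1)] -/
abbrev Vertex (V : Type*) (M ℓ : ℕ) : Type _ := V ⊕ Sym2 V × Fin M × Fin (ℓ + 1)

/-- A chosen first endpoint of the unordered pair `e` (`Quot.out`). [folklore] -/
noncomputable def src (e : Sym2 V) : V := (Quot.out e).1

/-- The other endpoint of the unordered pair `e` (`Quot.out`). [folklore] -/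
noncomputable def tgt (e : Sym2 V) : V := (Quot.out e).2

/-- `s(src e, tgt e) = e`. [folklore] -/
theorem mk_src_tgt (e : Sym2 V) : s(src e, tgt e) = e := Quot.out_eq e

/-- A pair is diagonal iff its two chosen endpoints coincide. [folklore] -/
theorem isDiag_iff_src_eq_tgt (e : Sym2 V) : e.IsDiag ↔ src e = tgt e := by
  conv_lhs => rw [← mk_src_tgt e]
  exact Sym2.mk_isDiag_iff

/-- The endpoints of a non-diagonal pair are distinct. [folklore] -/
theorem src_ne_tgt {e : Sym2 V} (h : ¬ e.IsDiag) : src e ≠ tgt e :=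
  fun h' => h ((isDiag_iff_src_eq_tgt e).2 h')

/-- Position `i ∈ {0, …, ℓ + 2}` on the `j`-th path over `e`: `0 ↦ inl (src e)`,
`i ↦ inr (e, j, i - 1)` for `1 ≤ i ≤ ℓ + 1`, and `ℓ + 2 ↦ inl (tgt e)`. [cite: KozmaNitzan2024, §5.6 (1)] -/
noncomputable def pos (e : Sym2 V) (j : Fin M) (i : Fin (ℓ + 3)) : Vertex V M ℓ :=
  if (i : ℕ) = 0 then Sum.inl (src e)
  else if h : (i : ℕ) ≤ ℓ + 1 then Sum.inr (e, j, ⟨(i : ℕ) - 1, by omega⟩)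
  else Sum.inl (tgt e)

/-- Position `0` is the original vertex `src e`. [folklore] -/
@[simp] theorem pos_zero (e : Sym2 V) (j : Fin M) : pos e j (0 : Fin (ℓ + 3)) = Sum.inl (src e) := by
  simp [pos]

/-- The last position `ℓ + 2` is the original vertex `tgt e`. [folklore] -/
@[simp] theorem pos_last (e : Sym2 V) (j : Fin M) :
    pos e j (Fin.last (ℓ + 2)) = Sum.inl (tgt e) := by
  simp [pos]

/-- Interior positions are internal vertices. [folklore] -/
theorem pos_of_interior (e : Sym2 V) (j : Fin M) (i : Fin (ℓ + 3)) (h1 : (i : ℕ) ≠ 0)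
    (h2 : (i : ℕ) ≤ ℓ + 1) : pos e j i = Sum.inr (e, j, ⟨(i : ℕ) - 1, by omega⟩) := by
  simp [pos, h1, h2]

/-- On a non-diagonal pair the position map of a path is injective. [folklore] -/
theorem pos_injective {e : Sym2 V} (he : ¬ e.IsDiag) (j : Fin M) :
    Function.Injective (pos (ℓ := ℓ) e j) := by
  intro i i' h
  have hst := src_ne_tgt he
  apply Fin.ext
  unfold pos at h
  split_ifs at h
  all_goals
    first
    | omega
    | exact absurd (Sum.inl.inj h) hst
    | exact absurd (Sum.inl.inj h).symm hst
    | exact absurd h Sum.inl_ne_inr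
    | exact absurd h Sum.inr_ne_inl
    | (have h' := congrArg Fin.val (Prod.ext_iff.1 (Prod.ext_iff.1 (Sum.inr.inj h)).2).2
       simp only at h'
       omega)

/-- The `k`-th edge (`k ≤ ℓ + 1`) of the `j`-th path over `e` joins positions `k` and `k + 1`. [cite: KozmaNitzan2024, §5.6 (1)] -/
noncomputable def edge (e : Sym2 V) (j : Fin M) (k : Fin (ℓ + 2)) : Sym2 (Vertex V M ℓ) :=
  s(pos e j k.castSucc, pos e j k.succ)

/-- Consecutive positions of a path over a non-diagonal pair are distinct. [folklore] -/
theorem pos_castSucc_ne_pos_succ {e : Sym2 V} (he : ¬ e.IsDiag) (j : Fin M) (k : Fin (ℓ + 2)) :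
    pos e j k.castSucc ≠ pos e j k.succ :=
  fun h => (Fin.castSucc_lt_succ (i := k)).ne (pos_injective he j h)

/-- An internal vertex lying on an edge of a path belongs to that path. [folklore] -/
theorem eq_of_inr_mem_edge {e e' : Sym2 V} {j j' : Fin M} {k' : Fin (ℓ + 1)} {k : Fin (ℓ + 2)}
    (h : (Sum.inr (e', j', k') : Vertex V M ℓ) ∈ edge e j k) : e' = e ∧ j' = j := by
  rw [edge, Sym2.mem_iff] at h
  rcases h with h | h
  all_goals
    unfold pos at h
    split_ifs at h
    all_goals
      first
      | exact absurd h Sum.inr_ne_inl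
      | (have h' := Prod.ext_iff.1 (Sum.inr.inj h)
         exact ⟨h'.1, (Prod.ext_iff.1 h'.2).1⟩)

/-- Every edge of a path contains an internal vertex of that path. [folklore] -/
theorem exists_inr_mem_edge (e : Sym2 V) (j : Fin M) (k : Fin (ℓ + 2)) :
    ∃ k' : Fin (ℓ + 1), (Sum.inr (e, j, k') : Vertex V M ℓ) ∈ edge e j k := by
  by_cases hk : (k : ℕ) = 0
  · refine ⟨⟨0, by omega⟩, ?_⟩
    rw [edge, Sym2.mem_iff]
    refine Or.inr ?_
    rw [pos_of_interior e j k.succ (by simp) (by simp [Fin.val_succ, hk])]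
    simp [Fin.val_succ, hk]
  · refine ⟨⟨(k : ℕ) - 1, by omega⟩, ?_⟩
    rw [edge, Sym2.mem_iff]
    refine Or.inl ?_
    rw [pos_of_interior e j k.castSucc (by simpa using hk) (by simp; omega)]
    simp

/-- Distinct paths have no edge in common. [folklore] -/
theorem edge_ne_edge {e e' : Sym2 V} {j j' : Fin M} (hne : e ≠ e' ∨ j ≠ j') (k k' : Fin (ℓ + 2)) :
    edge e j k ≠ edge e' j' k' := by
  intro h
  obtain ⟨k₀, hk₀⟩ := exists_inr_mem_edge e j k
  rw [h] at hk₀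
  obtain ⟨h1, h2⟩ := eq_of_inr_mem_edge hk₀
  rcases hne with hne | hne
  · exact hne h1
  · exact hne h2

/-- On a non-diagonal pair the edges of one path are pairwise distinct. [folklore] -/
theorem edge_injective {e : Sym2 V} (he : ¬ e.IsDiag) (j : Fin M) :
    Function.Injective (edge (ℓ := ℓ) e j) := by
  intro k k' h
  rw [edge, edge, Sym2.eq_iff] at h
  rcases h with ⟨h1, -⟩ | ⟨h1, h2⟩
  · exact Fin.castSucc_injective _ (pos_injective he j h1)
  · have h1' := congrArg Fin.val (pos_injective he j h1)
    have h2' := congrArg Fin.val (pos_injective he j h2)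
    simp only [Fin.val_castSucc, Fin.val_succ] at h1' h2'
    omega

/-- The `j`-th path over `e` is built iff `e` is not a loop and `j < m e`. [cite: KozmaNitzan2024, §5.6 (1)] -/
def Active (m : Sym2 V → ℕ) (e : Sym2 V) (j : Fin M) : Prop := ¬ e.IsDiag ∧ (j : ℕ) < m e

/-- **The gadget graph**: the union of the active paths (`min (m e) M` internally disjoint paths of
`ℓ + 2` edges over every non-diagonal pair `e`), a simple graph on `Vertex V M ℓ`. [cite: KozmaNitzan2024, §5.6 (1)] -/
def graph (M ℓ : ℕ) (m : Sym2 V → ℕ) : SimpleGraph (Vertex V M ℓ) :=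
  SimpleGraph.fromRel fun a b => ∃ (e : Sym2 V) (j : Fin M) (k : Fin (ℓ + 2)),
    Active m e j ∧ a = pos e j k.castSucc ∧ b = pos e j k.succ

/-- The edges of an active path are edges of the gadget graph. [folklore] -/
theorem edge_mem_edgeSet {m : Sym2 V → ℕ} {e : Sym2 V} {j : Fin M} (h : Active m e j)
    (k : Fin (ℓ + 2)) : edge e j k ∈ (graph M ℓ m).edgeSet := by
  rw [edge, SimpleGraph.mem_edgeSet, graph, SimpleGraph.fromRel_adj]
  exact ⟨pos_castSucc_ne_pos_succ h.1 j k, Or.inl ⟨e, j, k, h, rfl, rfl⟩⟩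

/-- The edge set of the gadget graph is exactly the set of edges of active paths. [folklore] -/
theorem mem_edgeSet_iff {m : Sym2 V → ℕ} {x : Sym2 (Vertex V M ℓ)} :
    x ∈ (graph M ℓ m).edgeSet ↔ ∃ (e : Sym2 V) (j : Fin M) (k : Fin (ℓ + 2)),
      Active m e j ∧ x = edge e j k := by
  induction x using Sym2.ind with
  | h a b =>
    constructor
    · intro hx
      rw [SimpleGraph.mem_edgeSet, graph, SimpleGraph.fromRel_adj] at hx
      rcases hx with ⟨-, ⟨e, j, k, h, rfl, rfl⟩ | ⟨e, j, k, h, rfl, rfl⟩⟩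
      · exact ⟨e, j, k, h, rfl⟩
      · exact ⟨e, j, k, h, Sym2.eq_swap⟩
    · rintro ⟨e, j, k, h, hx⟩
      rw [hx]
      exact edge_mem_edgeSet h k

/-- **The contraction** of a configuration of the gadget graph: the pair `e` is declared open
iff some active path over `e` is entirely open. [cite: KozmaNitzan2024, §5.6 (1)] -/
def contract (m : Sym2 V → ℕ) (ω : Set (Sym2 (Vertex V M ℓ))) : Set (Sym2 V) :=
  {e | ∃ j : Fin M, Active m e j ∧ ∀ k : Fin (ℓ + 2), edge e j k ∈ ω}

/-- Membership in the contraction. [folklore] -/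
theorem mem_contract_iff (m : Sym2 V → ℕ) (ω : Set (Sym2 (Vertex V M ℓ))) (e : Sym2 V) :
    e ∈ contract m ω ↔ ∃ j : Fin M, Active m e j ∧ ∀ k : Fin (ℓ + 2), edge e j k ∈ ω := Iff.rfl

/-- The contraction contains no diagonal pair. [folklore] -/
theorem not_isDiag_of_mem_contract {m : Sym2 V → ℕ} {ω : Set (Sym2 (Vertex V M ℓ))} {e : Sym2 V}
    (h : e ∈ contract m ω) : ¬ e.IsDiag := by
  obtain ⟨_, h, -⟩ := h
  exact h.1

/-! ### From the contraction to the gadget graph -/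

/-- Along an entirely open path every position is joined to position `0`. [folklore] -/
theorem reachable_pos_of_forall_mem {ω : Set (Sym2 (Vertex V M ℓ))} {e : Sym2 V} (he : ¬ e.IsDiag)
    {j : Fin M} (hω : ∀ k : Fin (ℓ + 2), edge e j k ∈ ω) (i : Fin (ℓ + 3)) :
    (openGraph ω).Reachable (pos e j 0) (pos e j i) := by
  induction i using Fin.induction with
  | zero => rfl
  | succ k ih =>
    refine ih.trans (SimpleGraph.Adj.reachable ?_)
    rw [openGraph_adj]
    exact ⟨hω k, pos_castSucc_ne_pos_succ he j k⟩

/-- An entirely open path joins (the copies of) the two endpoints of its pair. [folklore] -/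
theorem reachable_inl_src_tgt {ω : Set (Sym2 (Vertex V M ℓ))} {e : Sym2 V} (he : ¬ e.IsDiag)
    {j : Fin M} (hω : ∀ k : Fin (ℓ + 2), edge e j k ∈ ω) :
    (openGraph ω).Reachable (Sum.inl (src e)) (Sum.inl (tgt e)) := by
  have h := reachable_pos_of_forall_mem he hω (Fin.last (ℓ + 2))
  rwa [pos_zero, pos_last] at h

/-- **Connections lift**: if `u ↔ v` in the contraction then `inl u ↔ inl v` in the gadget
configuration. [cite: KozmaNitzan2024, §5.6 (1)] -/
theorem reachable_inl_of_reachable_contract {m : Sym2 V → ℕ} {ω : Set (Sym2 (Vertex V M ℓ))}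
    {u v : V} (h : (openGraph (contract m ω)).Reachable u v) :
    (openGraph ω).Reachable (Sum.inl u) (Sum.inl v) := by
  obtain ⟨p⟩ := h
  induction p with
  | nil => rfl
  | @cons a b c hadj _ ih =>
    refine SimpleGraph.Reachable.trans ?_ ih
    rw [openGraph_adj] at hadj
    obtain ⟨⟨j, hact, hP⟩, -⟩ := hadj
    have key := reachable_inl_src_tgt hact.1 hP
    have h2 := mk_src_tgt s(a, b)
    rw [Sym2.eq_iff] at h2
    rcases h2 with ⟨h1, h2⟩ | ⟨h1, h2⟩
    · rw [h1, h2] at key; exact key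
    · rw [h1, h2] at key; exact key.symm

/-! ### From the gadget graph to the contraction -/

open Classical in
/-- The CUT of the `j`-th path over `e` in `ω`: the index of a closed edge of the path if there is
one (so `≤ ℓ + 1`), and `ℓ + 2` if the path is entirely open. [folklore] -/
noncomputable def cut (ω : Set (Sym2 (Vertex V M ℓ))) (e : Sym2 V) (j : Fin M) : ℕ :=
  if h : ∃ k : Fin (ℓ + 2), edge e j k ∉ ω then ((Classical.choose h : Fin (ℓ + 2)) : ℕ) else ℓ + 2

/-- If the path has a closed edge, the cut is the index of a closed edge. [folklore] -/
theorem cut_spec {ω : Set (Sym2 (Vertex V M ℓ))} {e : Sym2 V} {j : Fin M}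
    (h : ∃ k : Fin (ℓ + 2), edge e j k ∉ ω) :
    ∃ k : Fin (ℓ + 2), (k : ℕ) = cut ω e j ∧ edge e j k ∉ ω := by
  refine ⟨Classical.choose h, ?_, Classical.choose_spec h⟩
  unfold cut
  rw [dif_pos h]

/-- The LABEL of a vertex: an original vertex is its own label; an internal vertex at position
`p` of the `j`-th path over `e` is labelled `src e` if `p ≤ cut` and `tgt e` otherwise. [folklore] -/
noncomputable def label (ω : Set (Sym2 (Vertex V M ℓ))) : Vertex V M ℓ → V
  | Sum.inl v => v
  | Sum.inr (e, j, k) => if (k : ℕ) + 1 ≤ cut ω e j then src e else tgt e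

/-- Labels of an original vertex. [folklore] -/
@[simp] theorem label_inl (ω : Set (Sym2 (Vertex V M ℓ))) (v : V) : label ω (Sum.inl v) = v := rfl

/-- Labels of an internal vertex. [folklore] -/
@[simp] theorem label_inr (ω : Set (Sym2 (Vertex V M ℓ))) (e : Sym2 V) (j : Fin M) (k : Fin (ℓ + 1)) :
    label ω (Sum.inr (e, j, k)) = if (k : ℕ) + 1 ≤ cut ω e j then src e else tgt e := rfl

/-- Every position of a path is labelled by one of the two endpoints of its pair. [folklore] -/
theorem label_pos_eq_or (ω : Set (Sym2 (Vertex V M ℓ))) (e : Sym2 V) (j : Fin M) (i : Fin (ℓ + 3)) :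
    label ω (pos e j i) = src e ∨ label ω (pos e j i) = tgt e := by
  unfold pos
  split_ifs with h1 h2
  · exact Or.inl rfl
  · rw [label_inr]
    split_ifs
    · exact Or.inl rfl
    · exact Or.inr rfl
  · exact Or.inr rfl

/-- When the path has a closed edge (cut `≤ ℓ + 1`), position `p` is labelled `src e` iff
`p ≤ cut`. [folklore] -/
theorem label_pos_of_cut_le {ω : Set (Sym2 (Vertex V M ℓ))} {e : Sym2 V} {j : Fin M}
    (hc : cut ω e j ≤ ℓ + 1) (i : Fin (ℓ + 3)) :
    label ω (pos e j i) = if (i : ℕ) ≤ cut ω e j then src e else tgt e := by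
  unfold pos
  split_ifs with h1 h2 h3 h4
  all_goals try rw [label_inr]
  all_goals try rw [label_inl]
  all_goals try split_ifs with h5
  all_goals try dsimp only at h5
  all_goals first | rfl | omega

/-- **The label step**: the two endpoints of an OPEN edge of an active path have labels that are
equal or adjacent in the contraction. [folklore] -/
theorem reachable_label_pos {m : Sym2 V → ℕ} {ω : Set (Sym2 (Vertex V M ℓ))} {e : Sym2 V}
    {j : Fin M} (hact : Active m e j) (k : Fin (ℓ + 2)) (hk : edge e j k ∈ ω) :
    (openGraph (contract m ω)).Reachable (label ω (pos e j k.castSucc))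
      (label ω (pos e j k.succ)) := by
  by_cases hall : ∀ k' : Fin (ℓ + 2), edge e j k' ∈ ω
  · -- entirely open path: `src e ∼ tgt e` in the contraction
    have hadj : (openGraph (contract m ω)).Adj (src e) (tgt e) := by
      rw [openGraph_adj, mk_src_tgt]
      exact ⟨⟨j, hact, hall⟩, src_ne_tgt hact.1⟩
    rcases label_pos_eq_or ω e j k.castSucc with h1 | h1 <;>
      rcases label_pos_eq_or ω e j k.succ with h2 | h2 <;> rw [h1, h2]
    · exact hadj.reachable
    · exact hadj.reachable.symm
  · -- a closed edge at index `cut ≠ k`: both labels agree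
    push Not at hall
    obtain ⟨c, hc, hcω⟩ := cut_spec hall
    have hcle : cut ω e j ≤ ℓ + 1 := by rw [← hc]; omega
    have hkc : (k : ℕ) ≠ cut ω e j := by
      intro h
      apply hcω
      rw [show c = k from Fin.ext (hc.trans h.symm)]
      exact hk
    rw [label_pos_of_cut_le hcle, label_pos_of_cut_le hcle]
    simp only [Fin.val_castSucc, Fin.val_succ]
    split_ifs with h1 h2 h2
    · rfl
    · omega
    · omega
    · rfl

/-- Labels of the endpoints of an open edge of the gadget graph are joined in the contraction. [folklore] -/
theorem reachable_label_of_adj {m : Sym2 V → ℕ} {ω : Set (Sym2 (Vertex V M ℓ))}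
    (hω : ω ⊆ (graph M ℓ m).edgeSet) {a b : Vertex V M ℓ} (hab : (openGraph ω).Adj a b) :
    (openGraph (contract m ω)).Reachable (label ω a) (label ω b) := by
  rw [openGraph_adj] at hab
  obtain ⟨e, j, k, hact, hx⟩ := mem_edgeSet_iff.1 (hω hab.1)
  have hk : edge e j k ∈ ω := hx ▸ hab.1
  have key := reachable_label_pos hact k hk
  rw [edge, Sym2.eq_iff] at hx
  rcases hx with ⟨rfl, rfl⟩ | ⟨rfl, rfl⟩
  · exact key
  · exact key.symm

/-- **Connections descend**: if `inl u ↔ inl v` in a configuration of the gadget graph then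
`u ↔ v` in its contraction. [cite: KozmaNitzan2024, §5.6 (1)] -/
theorem reachable_contract_of_reachable_inl {m : Sym2 V → ℕ} {ω : Set (Sym2 (Vertex V M ℓ))}
    (hω : ω ⊆ (graph M ℓ m).edgeSet) {u v : V}
    (h : (openGraph ω).Reachable (Sum.inl u) (Sum.inl v)) :
    (openGraph (contract m ω)).Reachable u v := by
  suffices key : ∀ a b : Vertex V M ℓ, (openGraph ω).Reachable a b →
      (openGraph (contract m ω)).Reachable (label ω a) (label ω b) by
    simpa using key _ _ h
  intro a b hab
  obtain ⟨p⟩ := hab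
  induction p with
  | nil => rfl
  | cons hadj _ ih => exact (reachable_label_of_adj hω hadj).trans ih

/-- **Gadget replacement preserves connections among the original vertices** (Kozma–Nitzan
§5.6 (1)): for a configuration of the gadget graph, `u ↔ v` in the contraction iff
`inl u ↔ inl v`. [cite: KozmaNitzan2024, §5.6 (1)] -/
theorem contract_mem_openConn_iff {m : Sym2 V → ℕ} {ω : Set (Sym2 (Vertex V M ℓ))}
    (hω : ω ⊆ (graph M ℓ m).edgeSet) (u v : V) :
    contract m ω ∈ openConn u v ↔ ω ∈ openConn (Sum.inl u) (Sum.inl v) :=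
  ⟨reachable_inl_of_reachable_contract, reachable_contract_of_reachable_inl hω⟩

end HalfGadget

end Literature.Probability.Percolation
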